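import Literature.NumberTheory.LFunctions.RudnickSarnakNExplicit
import Literature.NumberTheory.LFunctions.RiemannSiegelFacts
import Literature.NumberTheory.LFunctions.WeilExplicitArchTermProofs
import HarnessLib

/-!
# Selberg's `Ω`-theorem for `S(t)`, step 2a: the window kernel and the explicit formula at height `t`

Second file of the proof programme for the named fact
`Literature.NumberTheory.LFunctions.Selberg1946_zetaArgS_omega` (`SelbergArgOmega.lean`,
§ "Status of the discharge, and a proof programme"; step 4 is `SelbergArgOmegaPrimeMoments.lean`).
Tsang (*Some `Ω`-theorems for the Riemann zeta-function*, Acta Arith. 46 (1986), Lemma 5 and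
(3.3)–(3.6)) convolves `log ζ(σ + i(t+u))` with the Fejér-type kernel `(sin(τu/2)/(u/2))²` and moves
the contour, which needs `log ζ` inside the critical strip. Here the same information is obtained
from the PROVED Guinand–Weil explicit formula (`explicit_formula_holds`,
`WeilExplicitFormulaProofs.lean`) applied to the twisted dilate

  `h_{L,t}(u) = g₀(u/L) e^{-itu}`,   `g₀ = φ ⋆ φ̃` the fixed positive-definite bump of
  `RudnickSarnakNKernel.lean` (`supp g₀ ⊆ [-1/4, 1/4]`),

whose transform is `ĥ_{L,t}(s) = ĝ_L(s - it)` with `ĝ_L(s) = L ĝ₀(1/2 + L(s - 1/2))`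
(`weilMellin_gDil`), so that on the critical line `ĥ_{L,t}(1/2 + iy) = K_L(y - t)`,
`K_L(r) := L κ(Lr) ≥ 0` (`kerDil`, `κ = ker` of `RudnickSarnakNKernel.lean`): a non-negative window of
width `≍ 1/L` around the height `t`, of total mass `∫ K_L = 2π g₀(0)` (`integral_kerDil`, Mellin
inversion). Everything in this file is PROVED; the definitions are the concrete objects of the
argument (no named facts).

## Main results

* `explicit_formula_testFn` — for `L > 0` and every real `t`:
  `∑_ρ m(ρ) ĝ_L(ρ - it) = ĝ_L(-it) + ĝ_L(1 - it) - P_L(t) + (1/π) ∫ K_L(u - t) θ'(u) du`,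
  where `P_L(t) = ∑_{n ≤ e^{L/4}} Λ(n) n^{-1/2} g_L(log n)(n^{-it} + n^{it})` (`primeTerm`, a finite
  trigonometric polynomial, `weilPrimeTerm_testFn`) and `θ' = riemannSiegelThetaDeriv`: the
  archimedean term of the explicit formula is EXACTLY the smoothed derivative of the
  Riemann–Siegel theta function (`weilArchTerm_testFn`: `Re ψ(1/4 + iu/2) = 2θ'(u) + log π` and
  `∫ K_L = 2π g₀(0)` absorb the `-g(0) log π`). The sum over the zeros converges absolutely
  (`summable_norm_zeroSide_testFn`).
* `integral_weilMellin_sub_kerDil` — the off-line correction is an exact `t`-antiderivative: for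
  every `ρ = β + iγ ∈ ℂ`,
  `∫_{t₁}^{t₂} (ĝ_L(ρ - it) - K_L(γ - t)) dt = 𝒜_ρ(t₂) - 𝒜_ρ(t₁)`,
  `𝒜_ρ(t) := i ∫₀^{β-1/2} ĝ_L(1/2 + α + i(γ - t)) dα` (`offA`; by holomorphy of `ĝ_L`, the
  fundamental theorem of calculus in `α` and in `t`, and Fubini on `[t₁,t₂] × [0, β-1/2]`). This is
  Tsang's `2π ∑_{β>σ} ∫₀^{β-σ} V(γ - t - iα) dα`; `𝒜_ρ ≡ 0` for `β = 1/2`.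
* `norm_weilMellin_gDil_le`, `norm_offA_le`, `norm_polar_le` — the sizes:
  `‖ĝ_L(s)‖ ≤ L e^{L|Re s - 1/2|/4} D₀/(1 + L²(Im s)²)`, hence
  `‖𝒜_ρ(t)‖ ≤ |β - 1/2| L e^{L|β-1/2|/4} D₀/(1 + L²(γ - t)²)` and the polar terms are
  `≤ L e^{L/8} D₀/(1 + L²t²)`; with `L = 8 log log T` (support `e^{L/4} = (log T)²`, Tsang's `e^τ`)
  a zero off the line by `δ` weighs at most `(log T)^{2δ} ≤ log T`.
* `integral_primeTerm` — `∫_{t₁}^{t₂} P_L = 𝒱_L(t₂) - 𝒱_L(t₁)` with the trigonometric polynomial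
  `𝒱_L(t) = 2 ∑ Λ(n) g_L(log n) sin(t log n)/(√n log n)` (`primeV`), whose moments are the subject
  of `SelbergArgOmegaPrimeMoments.lean`.

The integration in `t`, the summation over the zeros against the counting function
`N(t) = zetaZeroCount t` and `S(t) = zetaArgS t`, and the resulting convolution identity
`∫ S(t+u) K_L(u) du = -𝒱_L(t) - Re ∑_ρ m(ρ)𝒜_ρ(t) + C_T + o(1)` on `[T, 2T]` (Tsang (3.4)–(3.6)) are
the next file of the programme.

## References

* [Tsang1986] K.-M. Tsang, *Some Ω-theorems for the Riemann zeta-function*, Acta Arith. 46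
  (1986), 369–395: Lemma 5 (pp. 378–380), §3 (3.3)–(3.6) (p. 381).
* A. Selberg, *Contributions to the theory of the Riemann zeta-function* (1946), §7 (cited
  through Tsang).
* [Bombieri2000Weil] E. Bombieri, *Remarks on Weil's quadratic functional in the theory of prime
  numbers I*, Rend. Lincei (9) 11 (2000), §2 Thm 2 (the explicit formula as used here).
-/

noncomputable section

open Complex Filter Set MeasureTheory
open scoped Real Topology ComplexConjugate ArithmeticFunction.vonMangoldt

namespace Literature.NumberTheory.LFunctions

namespace SelbergOmega

open RudnickSarnakN

/-! ## The dilated test function `g_L(u) = g₀(u/L)` -/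

/-- The dilated test function `g_L(u) := g₀(u/L)` (support `⊆ [-L/4, L/4]`). [folklore] -/
def gDil (L : ℝ) (u : ℝ) : ℂ := g0 (u / L)

variable {L : ℝ}

/-- `g_L` is a Weil test function for `L > 0`. [folklore] -/
theorem gDil_isWeilTest (hL : 0 < L) : IsWeilTest (gDil L) := by
  refine ⟨g0_isWeilTest.1.comp (contDiff_id.div_const L), ?_⟩
  have e : gDil L = g0 ∘ (Homeomorph.mulRight₀ L⁻¹ (inv_ne_zero hL.ne')) := by
    ext u; simp [gDil, div_eq_mul_inv]
  rw [e]
  exact g0_isWeilTest.2.comp_homeomorph _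

/-- `g_L` is even. [folklore] -/
theorem gDil_neg (L u : ℝ) : gDil L (-u) = gDil L u := by
  simp [gDil, neg_div, g0_neg]

/-- `g_L(0) = g₀(0)`. [folklore] -/
@[simp] theorem gDil_zero (L : ℝ) : gDil L 0 = g0 0 := by simp [gDil]

/-- `g_L` is real: `g_L(u) = Re g_L(u)`. [folklore] -/
theorem gDil_eq_re (L u : ℝ) : gDil L u = (((gDil L u).re : ℝ) : ℂ) := g0_eq_re _

/-- `g_L ≥ 0`. [folklore] -/
theorem gDil_re_nonneg (L u : ℝ) : 0 ≤ (gDil L u).re := g0_re_nonneg _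

/-- `‖g_L(u)‖ ≤ ∫ φ`. [folklore] -/
theorem norm_gDil_le (L u : ℝ) : ‖gDil L u‖ ≤ bumpMass := norm_g0_le _

/-- `g_L(u) = 0` for `|u| ≥ L/4` (`L > 0`). [folklore] -/
theorem gDil_eq_zero (hL : 0 < L) {u : ℝ} (hu : L / 4 ≤ |u|) : gDil L u = 0 := by
  refine g0_eq_zero ?_
  rw [abs_div, abs_of_pos hL, le_div_iff₀ hL]
  linarith

/-- `g_L` is continuous. [folklore] -/
theorem continuous_gDil (L : ℝ) : Continuous (gDil L) :=
  continuous_g0.comp (continuous_id.div_const L)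

/-- **Transform of the dilation**: `ĝ_L(s) = L ĝ₀(1/2 + L(s - 1/2))` (substitute `u = Lv`).
[folklore] -/
theorem weilMellin_gDil (hL : 0 < L) (s : ℂ) :
    weilMellin (gDil L) s = L * weilMellin g0 (1 / 2 + L * (s - 1 / 2)) := by
  unfold weilMellin gDil
  set F : ℝ → ℂ := fun v => g0 v * cexp ((1 / 2 + (L : ℂ) * (s - 1 / 2) - 1 / 2) * (v : ℂ)) with hF
  have h := Measure.integral_comp_mul_left F L⁻¹
  rw [inv_inv, abs_of_pos hL] at h
  have hL' : (L : ℂ) ≠ 0 := ofReal_ne_zero.2 hL.ne'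
  have hpt : ∀ u : ℝ, g0 (u / L) * cexp ((s - 1 / 2) * (u : ℂ)) = F (L⁻¹ * u) := by
    intro u
    simp only [hF]
    rw [div_eq_inv_mul]
    congr 2
    push_cast
    field_simp
    ring
  simp_rw [hpt, h]
  rfl

/-! ## The dilated kernel `K_L(r) = L κ(L r)` -/

/-- The dilated window kernel `K_L(r) := L κ(L r) = ĝ_L(1/2 + ir)`. [folklore] -/
def kerDil (L r : ℝ) : ℝ := L * ker (L * r)

/-- `ĝ_L(1/2 + ir) = K_L(r)`. [folklore] -/
theorem weilMellin_gDil_half (hL : 0 < L) (r : ℝ) :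
    weilMellin (gDil L) (1 / 2 + r * I) = (kerDil L r : ℂ) := by
  rw [weilMellin_gDil hL, kerDil]
  have : (1 / 2 + (L : ℂ) * (1 / 2 + (r : ℂ) * I - 1 / 2)) = 1 / 2 + ((L * r : ℝ) : ℂ) * I := by
    push_cast; ring
  rw [this, weilMellin_g0_half]
  push_cast
  rfl

/-- `K_L ≥ 0` for `L ≥ 0`. [folklore] -/
theorem kerDil_nonneg (hL : 0 ≤ L) (r : ℝ) : 0 ≤ kerDil L r :=
  mul_nonneg hL (ker_nonneg _)

/-- `K_L` is even. [folklore] -/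
theorem kerDil_neg (L r : ℝ) : kerDil L (-r) = kerDil L r := by
  simp [kerDil, ker_neg]

/-- `K_L` is continuous. [folklore] -/
theorem continuous_kerDil (L : ℝ) : Continuous (kerDil L) :=
  continuous_const.mul (continuous_ker.comp (continuous_const.mul continuous_id))

/-- Decay of `K_L`: `K_L(r) ≤ L C/(1 + L²r²)²`, with the constant `C` of `exists_ker_le`. [folklore] -/
theorem exists_kerDil_le : ∃ C : ℝ, 0 < C ∧ ∀ L : ℝ, 0 ≤ L → ∀ r : ℝ,
    kerDil L r ≤ L * C / (1 + (L * r) ^ 2) ^ 2 := by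
  obtain ⟨C, hC0, hC⟩ := exists_ker_le
  refine ⟨C, hC0, fun L hL r => ?_⟩
  rw [kerDil, mul_div_assoc]
  exact mul_le_mul_of_nonneg_left (hC _) hL

/-- For `L ≥ 1` the dilated kernel is dominated by the undilated majorant: `K_L(r) ≤ L C/(1 + r²)²`.
[folklore] -/
theorem exists_kerDil_le' : ∃ C : ℝ, 0 < C ∧ ∀ L : ℝ, 1 ≤ L → ∀ r : ℝ,
    kerDil L r ≤ L * C / (1 + r ^ 2) ^ 2 := by
  obtain ⟨C, hC0, hC⟩ := exists_kerDil_le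
  refine ⟨C, hC0, fun L hL r => (hC L (by linarith) r).trans ?_⟩
  have hL0 : 0 < L := by linarith
  have h1 : 1 + r ^ 2 ≤ 1 + (L * r) ^ 2 := by
    have hL2 : 1 ≤ L ^ 2 := by nlinarith
    rw [mul_pow]; nlinarith [mul_le_mul_of_nonneg_right hL2 (sq_nonneg r)]
  have h2 : (1 + r ^ 2) ^ 2 ≤ (1 + (L * r) ^ 2) ^ 2 := pow_le_pow_left₀ (by positivity) h1 2
  exact div_le_div_of_nonneg_left (by positivity) (by positivity) h2

/-- `∫ K_L = 2π g₀(0)` (Mellin inversion on the critical line, `integral_weilMellin_vertical`).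
[folklore] -/
theorem integral_kerDil (hL : 0 < L) : ∫ r : ℝ, (kerDil L r : ℂ) = 2 * π * g0 0 := by
  have h := integral_weilMellin_vertical (gDil_isWeilTest hL) (1 / 2)
  simp_rw [show ((1 / 2 : ℝ) : ℂ) = 1 / 2 by push_cast; ring, weilMellin_gDil_half hL] at h
  rw [h, gDil_zero]

/-- `K_L` is integrable. [folklore] -/
theorem integrable_kerDil (hL : 0 < L) : Integrable (kerDil L) := by
  have h := integrable_weilMellin_vertical (gDil_isWeilTest hL) (1 / 2)
  have h' : Integrable fun r : ℝ => ((kerDil L r : ℝ) : ℂ) := by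
    refine h.congr (Eventually.of_forall fun r => ?_)
    simp only
    rw [show ((1 / 2 : ℝ) : ℂ) = 1 / 2 by push_cast; ring, weilMellin_gDil_half hL]
  simpa using h'.re

/-- `∫ K_L = 2π Re g₀(0)`, real form. [folklore] -/
theorem integral_kerDil_real (hL : 0 < L) : ∫ r : ℝ, kerDil L r = 2 * π * (g0 0).re := by
  have h := integral_kerDil hL
  rw [integral_complex_ofReal] at h
  have := congrArg Complex.re h
  simp only [Complex.ofReal_re] at this
  rw [this]
  simp [Complex.mul_re]

/-! ## The twisted test function `h_{L,t}(u) = g_L(u) e^{-itu}` -/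

/-- The test function fed to the explicit formula: `h_{L,t}(u) := g_L(u) e^{-itu}`; its transform
is `ĥ(s) = ĝ_L(s - it)`, so on the critical line `ĥ(1/2 + iy) = K_L(y - t)` is the window around
`t`. [folklore] -/
def testFn (L t : ℝ) (u : ℝ) : ℂ :=
  gDil L u * cexp (((-(t * u) : ℝ) : ℂ) * I)

/-- `h_{L,t}` is a Weil test function. [folklore] -/
theorem testFn_isWeilTest (hL : 0 < L) (t : ℝ) : IsWeilTest (testFn L t) := by
  have h1 := gDil_isWeilTest hL
  have h2 : ContDiff ℝ (⊤ : ℕ∞) fun u : ℝ ↦ (((-(t * u) : ℝ)) : ℂ) :=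
    Complex.ofRealCLM.contDiff.comp ((contDiff_const.mul contDiff_id).neg)
  have h3 : ContDiff ℝ (⊤ : ℕ∞) fun u : ℝ ↦ cexp (((-(t * u) : ℝ) : ℂ) * I) :=
    Complex.contDiff_exp.comp (h2.mul contDiff_const)
  exact ⟨h1.1.mul h3, h1.2.mul_right⟩

/-- `h_{L,t}(0) = g₀(0)`. [folklore] -/
@[simp] theorem testFn_zero (L t : ℝ) : testFn L t 0 = g0 0 := by
  simp [testFn]

/-- **Transform of the twist**: `ĥ_{L,t}(s) = ĝ_L(s - it)`. [folklore] -/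
theorem weilMellin_testFn (L t : ℝ) (s : ℂ) :
    weilMellin (testFn L t) s = weilMellin (gDil L) (s - t * I) := by
  unfold weilMellin testFn
  congr 1 with u
  rw [mul_assoc, ← Complex.exp_add]
  congr 2
  push_cast
  ring

/-- On the critical line: `ĥ_{L,t}(1/2 + iy) = K_L(y - t)`. [folklore] -/
theorem weilMellin_testFn_half (hL : 0 < L) (t y : ℝ) :
    weilMellin (testFn L t) (1 / 2 + y * I) = (kerDil L (y - t) : ℂ) := by
  rw [weilMellin_testFn, show (1 / 2 + (y : ℂ) * I - t * I : ℂ) = 1 / 2 + ((y - t : ℝ) : ℂ) * I by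
    push_cast; ring, weilMellin_gDil_half hL]

/-! ## The prime term: a finite Dirichlet polynomial -/

/-- The cut-off `⌊e^{L/4}⌋`: `g_L(log n) = 0` for `n > e^{L/4}`. [folklore] -/
def nCut (L : ℝ) : ℕ := ⌊Real.exp (L / 4)⌋₊

/-- The prime term of the explicit formula for `h_{L,t}`:
`P_L(t) := ∑_{n ≤ e^{L/4}} Λ(n) n^{-1/2} g_L(log n) (e^{-it log n} + e^{it log n})`, a finite
trigonometric polynomial in `t`. [folklore] -/
def primeTerm (L t : ℝ) : ℂ :=
  ∑ n ∈ Finset.range (nCut L + 1), ((Λ n : ℝ) : ℂ) / (Real.sqrt n : ℂ) *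
    (gDil L (Real.log n) * (cexp ((((-(t * Real.log n)) : ℝ) : ℂ) * I) +
      cexp (((t * Real.log n : ℝ) : ℂ) * I)))

/-- Beyond the cut-off the test function vanishes at `± log n`. [folklore] -/
theorem gDil_log_eq_zero (hL : 0 < L) {n : ℕ} (hn : n ∉ Finset.range (nCut L + 1)) :
    gDil L (Real.log n) = 0 := by
  rw [Finset.mem_range, not_lt] at hn
  have hx : Real.exp (L / 4) < n := by
    have h1 : Real.exp (L / 4) < (nCut L : ℝ) + 1 := Nat.lt_floor_add_one _
    have h2 : ((nCut L : ℝ) + 1) ≤ n := by exact_mod_cast hn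
    exact h1.trans_le h2
  have hn0 : (0 : ℝ) < n := (Real.exp_pos _).trans hx
  refine gDil_eq_zero hL ?_
  rw [abs_of_nonneg (Real.log_nonneg (by
    have : (1 : ℝ) ≤ Real.exp (L / 4) := Real.one_le_exp (by linarith)
    linarith))]
  rw [Real.le_log_iff_exp_le hn0]
  exact hx.le

/-- The prime term of the explicit formula for `h_{L,t}` is the finite sum `P_L(t)`. [folklore] -/
theorem weilPrimeTerm_testFn (hL : 0 < L) (t : ℝ) : weilPrimeTerm (testFn L t) = primeTerm L t := by
  unfold weilPrimeTerm primeTerm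
  have hterm : ∀ n : ℕ, testFn L t (Real.log n) + testFn L t (-Real.log n) =
      gDil L (Real.log n) * (cexp ((((-(t * Real.log n)) : ℝ) : ℂ) * I) +
        cexp (((t * Real.log n : ℝ) : ℂ) * I)) := by
    intro n
    simp only [testFn]
    rw [gDil_neg, mul_add]
    congr 3
    push_cast
    ring
  simp_rw [hterm]
  refine tsum_eq_sum fun n hn ↦ ?_
  rw [gDil_log_eq_zero hL hn]
  simp

/-- `P_L(t)` is continuous in `t`. [folklore] -/
theorem continuous_primeTerm (L : ℝ) : Continuous (primeTerm L) := by
  unfold primeTerm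
  fun_prop

/-! ## The archimedean term is `(1/π) (K_L ⋆ θ')(t)` -/

/-- `Re ψ(1/4 + iu/2) = 2θ'(u) + log π` (definition of `θ'`, `riemannSiegelThetaDeriv`). [folklore] -/
theorem re_digamma_quarter_eq (u : ℝ) :
    (Complex.digamma (1 / 4 + u / 2 * I)).re = 2 * riemannSiegelThetaDeriv u + Real.log π := by
  rw [riemannSiegelThetaDeriv]; ring

/-- A linear bound for the archimedean weight: `|Re ψ(1/4 + iu/2)| ≤ C (1 + |u|)`. [folklore] -/
theorem exists_abs_re_digamma_quarter_le :
    ∃ C : ℝ, 0 < C ∧ ∀ u : ℝ, |(Complex.digamma (1 / 4 + u / 2 * I)).re| ≤ C * (1 + |u|) := by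
  obtain ⟨C, hC⟩ := Literature.Analysis.SpecialFunctions.Complex.exists_norm_digamma_vertical_le
    (a := 1 / 4) (by norm_num)
  refine ⟨max C 1, lt_max_of_lt_right one_pos, fun u ↦ ?_⟩
  have h := hC (u / 2)
  have e : ((1 / 4 : ℝ) : ℂ) + ((u / 2 : ℝ) : ℂ) * I = 1 / 4 + u / 2 * I := by push_cast; ring
  rw [e] at h
  have hlog : Real.log (1 + |u / 2|) ≤ |u| := by
    have h0 : 0 ≤ |u / 2| := abs_nonneg _
    have := Real.log_le_sub_one_of_pos (show 0 < 1 + |u / 2| by positivity)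
    rw [abs_div, abs_two] at this ⊢
    linarith [abs_nonneg u]
  calc |(Complex.digamma (1 / 4 + u / 2 * I)).re| ≤ ‖Complex.digamma (1 / 4 + u / 2 * I)‖ :=
        Complex.abs_re_le_norm _
    _ ≤ C + |u| := h.trans (by linarith)
    _ ≤ max C 1 * (1 + |u|) := by
        have h1 : C ≤ max C 1 := le_max_left _ _
        have h2 : (1 : ℝ) ≤ max C 1 := le_max_right _ _
        nlinarith [abs_nonneg u]

/-- A linear bound for `θ'`: `|θ'(u)| ≤ C (1 + |u|)`. [folklore] -/
theorem exists_abs_riemannSiegelThetaDeriv_le :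
    ∃ C : ℝ, 0 < C ∧ ∀ u : ℝ, |riemannSiegelThetaDeriv u| ≤ C * (1 + |u|) := by
  obtain ⟨C, hC0, hC⟩ := exists_abs_re_digamma_quarter_le
  refine ⟨C / 2 + |Real.log π| / 2, by positivity, fun u ↦ ?_⟩
  have h := hC u
  rw [re_digamma_quarter_eq] at h
  have h1 : |2 * riemannSiegelThetaDeriv u| ≤ C * (1 + |u|) + |Real.log π| := by
    have := abs_sub (2 * riemannSiegelThetaDeriv u + Real.log π) (Real.log π)
    rw [add_sub_cancel_right] at this
    linarith
  rw [abs_mul, abs_two] at h1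
  nlinarith [abs_nonneg u, abs_nonneg (Real.log π)]

/-- `θ'` is continuous. [folklore] -/
theorem continuous_thetaDeriv : Continuous riemannSiegelThetaDeriv :=
  continuous_riemannSiegelThetaDeriv_holds

/-- The smoothed archimedean weight is integrable: `u ↦ K_L(u - t) Re ψ(1/4 + iu/2)`. [folklore] -/
theorem integrable_kerDil_mul_re_digamma (hL : 0 < L) (t : ℝ) :
    Integrable fun u : ℝ ↦ ((Complex.digamma (1 / 4 + u / 2 * I)).re : ℂ) * (kerDil L (u - t) : ℂ) := by
  obtain ⟨C, -, hC⟩ := exists_abs_re_digamma_quarter_le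
  have hF : Continuous fun u : ℝ ↦ ((Complex.digamma (1 / 4 + u / 2 * I)).re : ℂ) :=
    Complex.continuous_ofReal.comp Literature.Analysis.SpecialFunctions.continuous_reDigammaQuarter
  have h := integrable_mul_weilMellin_vertical_of_norm_le_linear (testFn_isWeilTest hL t) (1 / 2) hF
    (C := C) fun y ↦ by rw [Complex.norm_real, Real.norm_eq_abs]; exact hC y
  refine h.congr (Eventually.of_forall fun u ↦ ?_)
  simp only
  rw [show ((1 / 2 : ℝ) : ℂ) = 1 / 2 by push_cast; ring, weilMellin_testFn_half hL]

/-- `u ↦ K_L(u - t) θ'(u)` is integrable. [folklore] -/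
theorem integrable_kerDil_mul_thetaDeriv (hL : 0 < L) (t : ℝ) :
    Integrable fun u : ℝ ↦ kerDil L (u - t) * riemannSiegelThetaDeriv u := by
  have h1 := (integrable_kerDil_mul_re_digamma hL t).re
  have h2 : Integrable fun u : ℝ ↦ kerDil L (u - t) :=
    (integrable_kerDil hL).comp_sub_right t
  have h3 : Integrable fun u : ℝ ↦
      ((Complex.digamma (1 / 4 + u / 2 * I)).re * kerDil L (u - t)) / 2 - Real.log π / 2 * kerDil L (u - t) :=
    (h1.congr (Eventually.of_forall fun u ↦ by simp)).div_const 2 |>.sub (h2.const_mul _)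
  refine h3.congr (Eventually.of_forall fun u ↦ ?_)
  simp only [riemannSiegelThetaDeriv]
  ring

/-- **The archimedean term of the explicit formula for `h_{L,t}` is `(1/π) ∫ K_L(u - t) θ'(u) du`**
(`θ'(u) = Re ψ(1/4 + iu/2)/2 - (log π)/2` and `∫ K_L = 2π g₀(0)` absorb the `-g(0) log π`).
[folklore] -/
theorem weilArchTerm_testFn (hL : 0 < L) (t : ℝ) :
    weilArchTerm (testFn L t) =
      (((1 / π) * ∫ u : ℝ, kerDil L (u - t) * riemannSiegelThetaDeriv u : ℝ) : ℂ) := by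
  rw [weilArchTerm, weilArchIntegral, testFn_zero]
  -- the integrand on the critical line
  have hint : (∫ u : ℝ, weilMellin (testFn L t) (1 / 2 + u * I) *
      ((Complex.digamma (1 / 4 + u / 2 * I)).re : ℂ)) =
      ∫ u : ℝ, ((2 * (kerDil L (u - t) * riemannSiegelThetaDeriv u) : ℝ) : ℂ) +
        (Real.log π : ℂ) * (kerDil L (u - t) : ℂ) := by
    congr 1 with u
    rw [weilMellin_testFn_half hL, re_digamma_quarter_eq]
    push_cast
    ring
  have hI1 : Integrable fun u : ℝ ↦ ((2 * (kerDil L (u - t) * riemannSiegelThetaDeriv u) : ℝ) : ℂ) :=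
    ((integrable_kerDil_mul_thetaDeriv hL t).const_mul 2).ofReal
  have hI2 : Integrable fun u : ℝ ↦ (Real.log π : ℂ) * (kerDil L (u - t) : ℂ) :=
    (((integrable_kerDil hL).comp_sub_right t).ofReal).const_mul _
  rw [hint, integral_add hI1 hI2, integral_const_mul, integral_complex_ofReal, integral_const_mul]
  have hK : (∫ u : ℝ, (kerDil L (u - t) : ℂ)) = 2 * π * g0 0 := by
    rw [integral_sub_right_eq_self (fun u ↦ (kerDil L u : ℂ)) t, integral_kerDil hL]
  rw [hK]
  have hπ : (π : ℂ) ≠ 0 := ofReal_ne_zero.2 Real.pi_ne_zero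
  push_cast
  field_simp
  ring

/-! ## The explicit formula for `h_{L,t}` -/

/-- The zero side of the explicit formula for `h_{L,t}` converges absolutely. [folklore] -/
theorem summable_norm_zeroSide_testFn (hL : 0 < L) (t : ℝ) :
    Summable fun ρ : ZetaZeros.riemannZetaNontrivialZeros ↦
      ‖(riemannZetaZeroOrder (ρ : ℂ) : ℂ) * weilMellin (gDil L) ((ρ : ℂ) - t * I)‖ := by
  have h := summable_norm_zeroSide (testFn_isWeilTest hL t)
  simpa only [weilMellin_testFn] using h

/-- **The Guinand–Weil explicit formula for the window `h_{L,t}`** (`explicit_formula_holds` for the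
test function `u ↦ g₀(u/L) e^{-itu}`):
`∑_ρ m(ρ) ĝ_L(ρ - it) = ĝ_L(-it) + ĝ_L(1 - it) - P_L(t) + (1/π) ∫ K_L(u - t) θ'(u) du`.
(Tsang 1986, Lemma 5 is the corresponding convolution formula for `log ζ`; here the zeros enter
through the explicit formula instead.) [folklore] -/
theorem explicit_formula_testFn (hL : 0 < L) (t : ℝ) :
    ∑' ρ : ZetaZeros.riemannZetaNontrivialZeros,
        (riemannZetaZeroOrder (ρ : ℂ) : ℂ) * weilMellin (gDil L) ((ρ : ℂ) - t * I) =
      weilMellin (gDil L) (-(t * I)) + weilMellin (gDil L) (1 - t * I) - primeTerm L t +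
        (((1 / π) * ∫ u : ℝ, kerDil L (u - t) * riemannSiegelThetaDeriv u : ℝ) : ℂ) := by
  set h := testFn L t with hh_def
  have hh : IsWeilTest h := testFn_isWeilTest hL t
  have hsum := summable_norm_zeroSide hh
  have h1 : HasWeilZeroSide h (∑' ρ : ZetaZeros.riemannZetaNontrivialZeros,
      (riemannZetaZeroOrder (ρ : ℂ) : ℂ) * weilMellin h ρ) := hasWeilZeroSide_tsum hsum
  have h2 : HasWeilZeroSide h (weilFunctional h) := explicit_formula_holds hh
  have hZ := tendsto_nhds_unique h1 h2
  simp only [hh_def, weilMellin_testFn] at hZ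
  rw [hZ, weilFunctional, weilPolarTerm, weilPrimeTerm_testFn hL, weilArchTerm_testFn hL,
    weilMellin_testFn, weilMellin_testFn, zero_sub]

/-! ## The off-line antiderivative `𝒜_ρ(t) = i ∫₀^{Re ρ - 1/2} ĝ_L(1/2 + α + i(Im ρ - t)) dα` -/

/-- `ĝ_L` is entire. [folklore] -/
theorem differentiable_weilMellin_gDil (hL : 0 < L) : Differentiable ℂ (weilMellin (gDil L)) :=
  differentiable_weilMellin (continuous_gDil L) (gDil_isWeilTest hL).2

/-- `(ĝ_L)'` is continuous. [folklore] -/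
theorem continuous_deriv_weilMellin_gDil (hL : 0 < L) : Continuous (deriv (weilMellin (gDil L))) := by
  have hA : AnalyticOnNhd ℂ (weilMellin (gDil L)) univ :=
    analyticOnNhd_weilMellin (continuous_gDil L) (gDil_isWeilTest hL).2 univ
  exact continuousOn_univ.1 hA.deriv.continuousOn

/-- The off-line antiderivative attached to a point `ρ = β + iγ`:
`𝒜_ρ(t) := i ∫₀^{β - 1/2} ĝ_L(1/2 + α + i(γ - t)) dα`. It vanishes identically for `β = 1/2`,
and `d/dt 𝒜_ρ(t) = ĝ_L(ρ - it) - K_L(γ - t)` (`integral_weilMellin_sub_kerDil`): the zeros off the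
critical line enter the smoothed counting function only through `𝒜_ρ`.
(Tsang 1986, Lemma 5: the term `2π ∑_{β>σ} ∫₀^{β-σ} V(γ - t - iα) dα`.) [cite: Tsang1986, Lemma 5] -/
def offA (L : ℝ) (ρ : ℂ) (t : ℝ) : ℂ :=
  I * ∫ α in (0 : ℝ)..(ρ.re - 1 / 2), weilMellin (gDil L) (1 / 2 + α + (ρ.im - t) * I)

/-- FTC in `α`: `∫₀^δ (ĝ_L)'(1/2 + α + iv) dα = ĝ_L(1/2 + δ + iv) - ĝ_L(1/2 + iv)`. [folklore] -/
theorem integral_deriv_weilMellin_dalpha (hL : 0 < L) (v : ℂ) (δ : ℝ) :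
    ∫ α in (0 : ℝ)..δ, deriv (weilMellin (gDil L)) (1 / 2 + α + v) =
      weilMellin (gDil L) (1 / 2 + δ + v) - weilMellin (gDil L) (1 / 2 + v) := by
  set G := weilMellin (gDil L) with hG
  have hd := differentiable_weilMellin_gDil hL
  have hderiv : ∀ α ∈ uIcc (0 : ℝ) δ,
      HasDerivAt (fun α : ℝ ↦ G (1 / 2 + α + v)) (deriv G (1 / 2 + α + v)) α := by
    intro α _
    have h1 : HasDerivAt G (deriv G ((α : ℂ) + (1 / 2 + v))) ((α : ℂ) + (1 / 2 + v)) :=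
      (hd _).hasDerivAt
    have h2 := (HasDerivAt.comp_add_const (α : ℂ) (1 / 2 + v) h1).comp_ofReal
    have e : ∀ y : ℝ, (y : ℂ) + (1 / 2 + v) = 1 / 2 + y + v := fun y ↦ by ring
    simp only [e] at h2
    exact h2
  have hint : IntervalIntegrable (fun α : ℝ ↦ deriv G (1 / 2 + α + v)) volume 0 δ :=
    ((continuous_deriv_weilMellin_gDil hL).comp (by fun_prop)).intervalIntegrable _ _
  rw [intervalIntegral.integral_eq_sub_of_hasDerivAt hderiv hint]
  simp

/-- FTC in `t`: `∫_{t₁}^{t₂} (ĝ_L)'(c - it) dt = i (ĝ_L(c - it₂) - ĝ_L(c - it₁))`. [folklore] -/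
theorem integral_deriv_weilMellin_dt (hL : 0 < L) (c : ℂ) (t₁ t₂ : ℝ) :
    ∫ t in t₁..t₂, deriv (weilMellin (gDil L)) (c - t * I) =
      I * (weilMellin (gDil L) (c - t₂ * I) - weilMellin (gDil L) (c - t₁ * I)) := by
  set G := weilMellin (gDil L) with hG
  have hd := differentiable_weilMellin_gDil hL
  have hderiv : ∀ t ∈ uIcc t₁ t₂,
      HasDerivAt (fun t : ℝ ↦ G (c - t * I)) (deriv G (c - t * I) * -I) t := by
    intro t _
    have h1 : HasDerivAt G (deriv G (c - t * I)) (c - t * I) := (hd _).hasDerivAt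
    have h2 : HasDerivAt (fun t : ℝ ↦ c - (t : ℂ) * I) (-I) t := by
      have := ((Complex.ofRealCLM.hasDerivAt (x := t)).mul_const I).const_sub c
      simpa using this
    exact h1.comp t h2
  have hint : IntervalIntegrable (fun t : ℝ ↦ deriv G (c - t * I) * -I) volume t₁ t₂ :=
    (((continuous_deriv_weilMellin_gDil hL).comp (by fun_prop)).mul continuous_const).intervalIntegrable _ _
  have h := intervalIntegral.integral_eq_sub_of_hasDerivAt hderiv hint
  rw [intervalIntegral.integral_mul_const] at h
  have hI : (-I : ℂ) ≠ 0 := neg_ne_zero.2 I_ne_zero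
  calc ∫ t in t₁..t₂, deriv G (c - t * I)
      = (∫ t in t₁..t₂, deriv G (c - t * I)) * -I * I := by
        rw [mul_assoc, neg_mul, I_mul_I, neg_neg, mul_one]
    _ = _ := by rw [h]; ring

/-- Fubini on the rectangle `[t₁, t₂] × [0, δ]` for the continuous integrand `(ĝ_L)'`. [folklore] -/
theorem integral_integral_deriv_swap (hL : 0 < L) (γ δ t₁ t₂ : ℝ) :
    ∫ t in t₁..t₂, ∫ α in (0 : ℝ)..δ, deriv (weilMellin (gDil L)) (1 / 2 + α + (γ - t) * I) =
      ∫ α in (0 : ℝ)..δ, ∫ t in t₁..t₂, deriv (weilMellin (gDil L)) (1 / 2 + α + (γ - t) * I) := by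
  refine intervalIntegral_intervalIntegral_swap ?_
  have hc : Continuous (Function.uncurry fun (t α : ℝ) ↦
      deriv (weilMellin (gDil L)) (1 / 2 + α + (γ - t) * I)) :=
    (continuous_deriv_weilMellin_gDil hL).comp (by fun_prop)
  exact (hc.continuousOn.integrableOn_compact (isCompact_uIcc.prod isCompact_uIcc)).mono_set
    (prod_mono uIoc_subset_uIcc uIoc_subset_uIcc)

/-- **The off-line term is an exact antiderivative**: for every `ρ ∈ ℂ` and real `t₁, t₂`,
`∫_{t₁}^{t₂} (ĝ_L(ρ - it) - K_L(Im ρ - t)) dt = 𝒜_ρ(t₂) - 𝒜_ρ(t₁)`. [folklore] -/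
theorem integral_weilMellin_sub_kerDil (hL : 0 < L) (ρ : ℂ) (t₁ t₂ : ℝ) :
    ∫ t in t₁..t₂, (weilMellin (gDil L) (ρ - t * I) - (kerDil L (ρ.im - t) : ℂ)) =
      offA L ρ t₂ - offA L ρ t₁ := by
  set δ : ℝ := ρ.re - 1 / 2 with hδ
  set γ : ℝ := ρ.im with hγ
  -- pointwise: the difference is an `α`-integral of `G'`
  have hpt : ∀ t : ℝ, weilMellin (gDil L) (ρ - t * I) - (kerDil L (γ - t) : ℂ) =
      ∫ α in (0 : ℝ)..δ, deriv (weilMellin (gDil L)) (1 / 2 + α + (γ - t) * I) := by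
    intro t
    rw [integral_deriv_weilMellin_dalpha hL ((γ - t) * I) δ]
    congr 1
    · congr 1
      apply Complex.ext <;> simp [hδ, hγ]
    · rw [← weilMellin_gDil_half hL]
      congr 1
      push_cast
      simp [hγ]
  simp_rw [hpt]
  rw [integral_integral_deriv_swap hL]
  have hinner : ∀ α : ℝ, ∫ t in t₁..t₂, deriv (weilMellin (gDil L)) (1 / 2 + α + (γ - t) * I) =
      I * (weilMellin (gDil L) (1 / 2 + α + (γ - t₂) * I) - weilMellin (gDil L) (1 / 2 + α + (γ - t₁) * I)) := by
    intro α
    have h := integral_deriv_weilMellin_dt hL (1 / 2 + α + γ * I) t₁ t₂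
    have e : ∀ t : ℝ, (1 / 2 + (α : ℂ) + γ * I - t * I) = 1 / 2 + α + (γ - t) * I := fun t ↦ by
      ring
    simp only [e] at h
    exact h
  simp_rw [hinner]
  have hc1 : Continuous fun α : ℝ ↦ weilMellin (gDil L) (1 / 2 + α + (γ - t₂) * I) :=
    (continuous_weilMellin (continuous_gDil L) (gDil_isWeilTest hL).2).comp (by fun_prop)
  have hc2 : Continuous fun α : ℝ ↦ weilMellin (gDil L) (1 / 2 + α + (γ - t₁) * I) :=
    (continuous_weilMellin (continuous_gDil L) (gDil_isWeilTest hL).2).comp (by fun_prop)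
  rw [intervalIntegral.integral_const_mul, intervalIntegral.integral_sub (hc1.intervalIntegrable _ _)
    (hc2.intervalIntegrable _ _)]
  simp only [offA, hδ, hγ]
  ring

/-! ## Growth of `ĝ_L` off the critical line -/

/-- For a function supported in `[-a, a]`: `∫ ‖g‖ e^{A|t|} ≤ e^{Aa} ∫ ‖g‖` (`A ≥ 0`). [folklore] -/
theorem weilL1W_le_exp_mul {g : ℝ → ℂ} (hg : Continuous g) (hg' : HasCompactSupport g) {a : ℝ}
    (hsupp : tsupport g ⊆ Icc (-a) a) {A : ℝ} (hA : 0 ≤ A) :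
    weilL1W A g ≤ Real.exp (A * a) * weilL1W 0 g := by
  unfold weilL1W
  simp only [zero_mul, Real.exp_zero, mul_one]
  rw [← integral_const_mul]
  refine integral_mono_of_nonneg (Eventually.of_forall fun t ↦ by positivity) ?_
    (Eventually.of_forall fun t ↦ ?_)
  · exact (hg.norm.integrable_of_hasCompactSupport hg'.norm).const_mul _
  · simp only
    by_cases ht : t ∈ tsupport g
    · have hta : |t| ≤ a := abs_le.2 ⟨by linarith [(hsupp ht).1], (hsupp ht).2⟩
      rw [mul_comm (Real.exp (A * a))]
      exact mul_le_mul_of_nonneg_left (Real.exp_le_exp.2 (mul_le_mul_of_nonneg_left hta hA))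
        (norm_nonneg _)
    · rw [image_eq_zero_of_notMem_tsupport ht]
      simp

/-- The strip constants of `g₀` grow at most like `e^{A/4}`: `C_{g₀,A} ≤ e^{A/4} C_{g₀,0}`
(`supp g₀ ⊆ [-1/4, 1/4]`). [folklore] -/
theorem weilDecayW_g0_le {A : ℝ} (hA : 0 ≤ A) :
    weilDecayW A g0 ≤ Real.exp (A / 4) * weilDecayW 0 g0 := by
  unfold weilDecayW
  have h1 := weilL1W_le_exp_mul continuous_g0 g0_isWeilTest.2 tsupport_g0_subset hA
  have h2 := weilL1W_le_exp_mul g0_isWeilTest.deriv.deriv.1.continuous g0_isWeilTest.deriv.deriv.2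
    ((tsupport_deriv_subset.trans tsupport_deriv_subset).trans tsupport_g0_subset) hA
  rw [show A * (1 / 4) = A / 4 by ring] at h1 h2
  linarith

/-- The constant `D₀ := C_{g₀,0} = ∫ ‖g₀‖ + ∫ ‖g₀''‖` of the kernel. [folklore] -/
def decayD0 : ℝ := weilDecayW 0 g0

/-- `D₀ ≥ 0`. [folklore] -/
theorem decayD0_nonneg : 0 ≤ decayD0 := weilDecayW_nonneg _ _

/-- **Growth of `ĝ_L` off the line**:
`‖ĝ_L(s)‖ ≤ L e^{L|Re s - 1/2|/4} D₀ / (1 + L² (Im s)²)` — exponential in the distance to the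
critical line at rate `L/4` (the support of `g_L`), and decaying in the height at scale `1/L`.
[folklore] -/
theorem norm_weilMellin_gDil_le (hL : 0 < L) (s : ℂ) :
    ‖weilMellin (gDil L) s‖ ≤
      L * Real.exp (L * |s.re - 1 / 2| / 4) * decayD0 / (1 + (L * s.im) ^ 2) := by
  rw [weilMellin_gDil hL, norm_mul, Complex.norm_real, Real.norm_of_nonneg hL.le]
  set s' : ℂ := 1 / 2 + L * (s - 1 / 2) with hs'
  have hre : s'.re - 1 / 2 = L * (s.re - 1 / 2) := by simp [hs', mul_re]
  have him : s'.im = L * s.im := by simp [hs', mul_im]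
  have hA : |s'.re - 1 / 2| ≤ L * |s.re - 1 / 2| := by rw [hre, abs_mul, abs_of_pos hL]
  have h1 := norm_weilMellin_le_of_abs_re_le g0_isWeilTest hA
  have h2 := weilDecayW_g0_le (A := L * |s.re - 1 / 2|) (by positivity)
  rw [him] at h1
  have hpos : 0 < 1 + (L * s.im) ^ 2 := by positivity
  have h2' : weilDecayW (L * |s.re - 1 / 2|) g0 ≤ Real.exp (L * |s.re - 1 / 2| / 4) * decayD0 := h2
  calc L * ‖weilMellin g0 s'‖ ≤ L * (weilDecayW (L * |s.re - 1 / 2|) g0 / (1 + (L * s.im) ^ 2)) :=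
        mul_le_mul_of_nonneg_left h1 hL.le
    _ ≤ L * (Real.exp (L * |s.re - 1 / 2| / 4) * decayD0 / (1 + (L * s.im) ^ 2)) := by
        gcongr
    _ = _ := by ring

/-- **Size of the off-line term**: for `ρ = β + iγ`,
`‖𝒜_ρ(t)‖ ≤ |β - 1/2| · L e^{L|β - 1/2|/4} D₀ / (1 + L²(γ - t)²)`. It is small unless `ρ` is off
the line AND within `O(1/L)` of the height `t`. [folklore] -/
theorem norm_offA_le (hL : 0 < L) (ρ : ℂ) (t : ℝ) :
    ‖offA L ρ t‖ ≤ |ρ.re - 1 / 2| *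
      (L * Real.exp (L * |ρ.re - 1 / 2| / 4) * decayD0 / (1 + (L * (ρ.im - t)) ^ 2)) := by
  rw [offA, norm_mul, Complex.norm_I, one_mul]
  set B : ℝ := L * Real.exp (L * |ρ.re - 1 / 2| / 4) * decayD0 / (1 + (L * (ρ.im - t)) ^ 2) with hB
  have hbound : ∀ α ∈ Set.uIoc (0 : ℝ) (ρ.re - 1 / 2),
      ‖weilMellin (gDil L) (1 / 2 + α + (ρ.im - t) * I)‖ ≤ B := by
    intro α hα
    refine (norm_weilMellin_gDil_le hL _).trans ?_
    have hre : (1 / 2 + (α : ℂ) + (ρ.im - t) * I).re - 1 / 2 = α := by simp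
    have him : (1 / 2 + (α : ℂ) + (ρ.im - t) * I).im = ρ.im - t := by simp
    rw [hre, him, hB]
    have hα' : |α| ≤ |ρ.re - 1 / 2| := by
      rcases mem_uIoc.1 hα with ⟨h0, h1⟩ | ⟨h0, h1⟩
      · rw [abs_of_pos h0]
        exact h1.trans (le_abs_self _)
      · rw [abs_of_nonpos h1, abs_of_neg (by linarith)]
        linarith
    have hpos : 0 < 1 + (L * (ρ.im - t)) ^ 2 := by positivity
    refine div_le_div_of_nonneg_right ?_ hpos.le
    refine mul_le_mul_of_nonneg_right (mul_le_mul_of_nonneg_left (Real.exp_le_exp.2 ?_) hL.le)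
      decayD0_nonneg
    exact div_le_div_of_nonneg_right (mul_le_mul_of_nonneg_left hα' hL.le) (by norm_num)
  have h := intervalIntegral.norm_integral_le_of_norm_le_const hbound
  rw [sub_zero] at h
  linarith

/-- `𝒜_ρ(t) = 0` for `ρ` on the critical line. [folklore] -/
theorem offA_eq_zero_of_re_eq_half {ρ : ℂ} (hρ : ρ.re = 1 / 2) (L t : ℝ) : offA L ρ t = 0 := by
  simp [offA, hρ]

/-- `t ↦ 𝒜_ρ(t)` is continuous. [folklore] -/
theorem continuous_offA (hL : 0 < L) (ρ : ℂ) : Continuous (offA L ρ) := by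
  unfold offA
  refine continuous_const.mul ?_
  have hc : Continuous (Function.uncurry fun (t α : ℝ) ↦
      weilMellin (gDil L) (1 / 2 + α + (ρ.im - t) * I)) :=
    (continuous_weilMellin (continuous_gDil L) (gDil_isWeilTest hL).2).comp (by fun_prop)
  exact intervalIntegral.continuous_parametric_intervalIntegral_of_continuous' hc _ _

/-! ## The prime term integrates to a trigonometric polynomial -/

/-- The `t`-antiderivative of the prime term:
`𝒱_L(t) := ∑_{2 ≤ n ≤ e^{L/4}} Λ(n) n^{-1/2} g_L(log n) · (i/log n)(e^{-it log n} - e^{it log n})`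
`= 2 ∑ Λ(n) g_L(log n) sin(t log n)/(√n log n)`. [folklore] -/
def primeV (L t : ℝ) : ℂ :=
  ∑ n ∈ Finset.range (nCut L + 1), ((Λ n : ℝ) : ℂ) / (Real.sqrt n : ℂ) *
    (gDil L (Real.log n) * ((I / (Real.log n : ℂ)) * (cexp ((((-(t * Real.log n)) : ℝ) : ℂ) * I) -
      cexp (((t * Real.log n : ℝ) : ℂ) * I))))

/-- `∫_{t₁}^{t₂} (e^{-itℓ} + e^{itℓ}) dt = (i/ℓ)(e^{-it₂ℓ} - e^{it₂ℓ}) - (i/ℓ)(e^{-it₁ℓ} - e^{it₁ℓ})` for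
`ℓ ≠ 0`. [folklore] -/
theorem integral_cexp_add_cexp {ℓ : ℝ} (hℓ : ℓ ≠ 0) (t₁ t₂ : ℝ) :
    ∫ t in t₁..t₂, (cexp ((((-(t * ℓ)) : ℝ) : ℂ) * I) + cexp (((t * ℓ : ℝ) : ℂ) * I)) =
      (I / (ℓ : ℂ)) * (cexp ((((-(t₂ * ℓ)) : ℝ) : ℂ) * I) - cexp (((t₂ * ℓ : ℝ) : ℂ) * I)) -
        (I / (ℓ : ℂ)) * (cexp ((((-(t₁ * ℓ)) : ℝ) : ℂ) * I) - cexp (((t₁ * ℓ : ℝ) : ℂ) * I)) := by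
  have hc1 : (-(ℓ : ℂ) * I) ≠ 0 := mul_ne_zero (neg_ne_zero.2 (ofReal_ne_zero.2 hℓ)) I_ne_zero
  have hc2 : ((ℓ : ℂ) * I) ≠ 0 := mul_ne_zero (ofReal_ne_zero.2 hℓ) I_ne_zero
  have h1 := integral_exp_mul_complex (a := t₁) (b := t₂) hc1
  have h2 := integral_exp_mul_complex (a := t₁) (b := t₂) hc2
  have e1 : ∀ t : ℝ, cexp ((((-(t * ℓ)) : ℝ) : ℂ) * I) = cexp (-(ℓ : ℂ) * I * t) := fun t ↦ by
    congr 1; push_cast; ring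
  have e2 : ∀ t : ℝ, cexp (((t * ℓ : ℝ) : ℂ) * I) = cexp ((ℓ : ℂ) * I * t) := fun t ↦ by
    congr 1; push_cast; ring
  simp_rw [e1, e2]
  rw [intervalIntegral.integral_add ((Continuous.intervalIntegrable (by fun_prop) _ _))
    ((Continuous.intervalIntegrable (by fun_prop) _ _)), h1, h2]
  have hℓ' : (ℓ : ℂ) ≠ 0 := ofReal_ne_zero.2 hℓ
  field_simp
  ring_nf
  rw [I_sq]
  ring

/-- **`∫_{t₁}^{t₂} P_L(t) dt = 𝒱_L(t₂) - 𝒱_L(t₁)`** (termwise; the terms `n = 0, 1` vanish since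
`Λ(0) = Λ(1) = 0`). [folklore] -/
theorem integral_primeTerm (L t₁ t₂ : ℝ) :
    ∫ t in t₁..t₂, primeTerm L t = primeV L t₂ - primeV L t₁ := by
  unfold primeTerm primeV
  rw [intervalIntegral.integral_finsetSum (fun n _ ↦ (Continuous.intervalIntegrable (by fun_prop) _ _)),
    ← Finset.sum_sub_distrib]
  refine Finset.sum_congr rfl fun n _ ↦ ?_
  rcases Nat.lt_or_ge n 2 with hn | hn
  · interval_cases n <;> simp
  · have hℓ : Real.log n ≠ 0 := by
      have : (1 : ℝ) < n := by exact_mod_cast hn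
      exact (Real.log_pos this).ne'
    rw [intervalIntegral.integral_const_mul, intervalIntegral.integral_const_mul,
      integral_cexp_add_cexp hℓ]
    ring

/-- `𝒱_L` is continuous. [folklore] -/
theorem continuous_primeV (L : ℝ) : Continuous (primeV L) := by
  unfold primeV
  fun_prop

/-! ## The polar terms are negligible at height `t` -/

/-- **Polar terms**: `‖ĝ_L(-it)‖ ≤ L e^{L/8} D₀/(1 + L²t²)` and the same for `ĝ_L(1 - it)`. [folklore] -/
theorem norm_polar_le (hL : 0 < L) (t : ℝ) :
    ‖weilMellin (gDil L) (-(t * I))‖ ≤ L * Real.exp (L / 8) * decayD0 / (1 + (L * t) ^ 2) ∧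
    ‖weilMellin (gDil L) (1 - t * I)‖ ≤ L * Real.exp (L / 8) * decayD0 / (1 + (L * t) ^ 2) := by
  have h1 := norm_weilMellin_gDil_le hL (-(t * I))
  have h2 := norm_weilMellin_gDil_le hL (1 - t * I)
  have e1 : |(-((t : ℂ) * I)).re - 1 / 2| = 1 / 2 := by norm_num
  have e2 : |(1 - (t : ℂ) * I).re - 1 / 2| = 1 / 2 := by norm_num
  have e3 : (L * (-((t : ℂ) * I)).im) ^ 2 = (L * t) ^ 2 := by simp
  have e4 : (L * (1 - (t : ℂ) * I).im) ^ 2 = (L * t) ^ 2 := by simp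
  rw [e1, e3] at h1
  rw [e2, e4] at h2
  have e5 : L * (1 / 2) / 4 = L / 8 := by ring
  rw [e5] at h1 h2
  exact ⟨h1, h2⟩

end SelbergOmega

end Literature.NumberTheory.LFunctions

end
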